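import Literature.NumberTheory.QuadraticFields.BinaryQuadraticFormsClassNumber
import HarnessLib

/-!
# A fast kernel counter for the form class number `h(D)`, `D < 0` (Cohen's Algorithm 5.3.5), proved equal to
# `BinQF.classNumber`

Topic `NumberTheory/QuadraticFields`, namespace `Literature.NumberTheory.QuadraticFields.Quadratic` (sub-namespace `BinQF`);
continues `BinaryQuadraticFormsClassNumber.lean`, whose `BinQF.classNumber D` (the number of reduced primitive positive
definite forms of discriminant `D < 0`, Cox Thm. 2.13) is computable but enumerates `≈ 2|D|/3` candidate triples behind a
linear search for the bound `⌊√(|D|/3)⌋` (`decide +kernel`: ≈ 40 s per 10⁵ of `|D|`). This file adds the classical COUNT BY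
PAIRS (Cohen, *A Course in Computational Algebraic Number Theory*, Algorithm 5.3.5; Buell, *Binary Quadratic Forms*, §2):
for `N = |D|`, run over `1 ≤ a ≤ ⌊√(N/3)⌋` and `0 ≤ b ≤ a` with `b ≡ N (mod 2)`, keep the pairs with `4a ∣ b² + N`,
`c := (b² + N)/4a ≥ a` and `gcd(a, b, c) = 1`, and count such a pair ONCE if it lies on the boundary `b = 0 ∨ b = a ∨ a = c`
(only `(a, b, c)` is reduced) and TWICE otherwise (`(a, ±b, c)` are both reduced). Everything is PROVED:

* computable plumbing `BinQF.redPairC / redPairOK / redPairWeight / redPairCount / redRowSum / redRowLen / redRowsSum /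
  countBound` and **`BinQF.classNumberCount N`** (structural recursion only, all arithmetic in `ℕ`, so that the kernel's
  GMP-backed `Nat` operations do the work: `|D| = 77 683` in ≈ 2 s, `|D| = 1 333 963` in ≈ 20 s — about `|D|/65 000` s);
* the unrolling `classNumberCount_eq_sum`: `classNumberCount N = ∑_{(a,b) ∈ redPairSet N} redPairWeight N a b`;
* the bijection: `absPair f = (a, |b|)` maps the reduced forms of discriminant `−N` into `redPairSet N`
  (`absPair_mem_redPairSet`), and the fibre over an admissible pair is `{(a, b, c)}` on the boundary and `{(a, b, c), (a, −b, c)}`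
  off it (`filter_absPair_eq`, `card_filter_absPair_eq`) — Cox, (2.4)/(2.8) and Thm. 2.8;
* **`classNumber_neg_eq_classNumberCount`**: `classNumber (−N) = classNumberCount N` for every `N > 0`, and the `D`-form
  **`classNumber_eq_classNumberCount`**: `classNumber D = classNumberCount |D|` for every `D < 0`;
* regressions `classNumberCount_examples` (`h = 1, 1, 2, 3, 8, 22` at `N = 3, 4, 15, 23, 1155, 77683`, the values already in the
  tree by the slow route).

First consumer: `ImaginaryQuadraticClassNumbersDeep.lean` (the landau-siegel rescue bed's deep ladder rungs
`|D| = 1 333 963 … 51 599 563`, out of reach of the candidate enumeration).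

## References

* [Cohen1993] H. Cohen, *A Course in Computational Algebraic Number Theory*, GTM 138 (1993), §5.3.1, Algorithm 5.3.5
  (class number of an imaginary quadratic order by counting reduced forms).
* [Cox2013] D. A. Cox, *Primes of the form x² + ny²*, 2nd ed. (2013), §2.A (2.4), (2.8), Thm. 2.8, Thm. 2.13.
* [Buell1989] D. A. Buell, *Binary Quadratic Forms*, Springer (1989), §2 (reduced forms, the bound `a ≤ √(|D|/3)`).
-/

namespace Literature.NumberTheory.QuadraticFields.Quadratic

namespace BinQF

open Finset

/-! ### The counter (computable, `ℕ` arithmetic only) -/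

/-- The third coefficient attached to the pair `(a, b)` at `N = |D|`: `c(a, b) = (b² + N)/(4a)` (integer division).
[cite: Cohen1993, §5.3.1 Algorithm 5.3.5] -/
def redPairC (N a b : ℕ) : ℕ := (b * b + N) / (4 * a)

/-- The admissibility test of the pair `(a, b)`: `4a ∣ b² + N`, `a ≤ c(a, b)` and `gcd(a, b, c(a, b)) = 1`.
[cite: Cohen1993, §5.3.1 Algorithm 5.3.5] -/
def redPairOK (N a b : ℕ) : Bool :=
  decide ((b * b + N) % (4 * a) = 0) && decide (a ≤ redPairC N a b) &&
    decide (Nat.gcd (Nat.gcd a b) (redPairC N a b) = 1)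

/-- The weight of an admissible pair: `1` on the boundary `b = 0 ∨ b = a ∨ a = c` (only `(a, b, c)` is reduced), `2` off it
(`(a, b, c)` and `(a, −b, c)` are both reduced). [cite: Cohen1993, §5.3.1 Algorithm 5.3.5] -/
def redPairWeight (N a b : ℕ) : ℕ := if b = 0 ∨ b = a ∨ a = redPairC N a b then 1 else 2

/-- The contribution of the pair `(a, b)` to `h(−N)`: its weight if admissible, else `0`.
[cite: Cohen1993, §5.3.1 Algorithm 5.3.5] -/
def redPairCount (N a b : ℕ) : ℕ := if redPairOK N a b then redPairWeight N a b else 0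

/-- Partial sum of row `a` over the `b` of the parity of `N`: `∑_{j < k} redPairCount N a (2j + N % 2)`.
[cite: Cohen1993, §5.3.1 Algorithm 5.3.5] -/
def redRowSum (N a : ℕ) : ℕ → ℕ
  | 0 => 0
  | k + 1 => redRowSum N a k + redPairCount N a (2 * k + N % 2)

/-- The number of `j` with `2j + N % 2 ≤ a`. [cite: Cohen1993, §5.3.1 Algorithm 5.3.5] -/
def redRowLen (N a : ℕ) : ℕ := (a - N % 2) / 2 + 1

/-- The sum of the rows `a = 1, …, k`. [cite: Cohen1993, §5.3.1 Algorithm 5.3.5] -/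
def redRowsSum (N : ℕ) : ℕ → ℕ
  | 0 => 0
  | k + 1 => redRowsSum N k + redRowSum N (k + 1) (redRowLen N (k + 1))

/-- The bound `⌊√(N/3)⌋` for the leading coefficient of a reduced form of discriminant `−N` (Cox (2.8)), by `Nat.sqrt`.
[cite: Cox2013, §2.A eq. (2.8)] -/
def countBound (N : ℕ) : ℕ := Nat.sqrt (N / 3)

/-- **The pair counter** `classNumberCount N` = the number of reduced primitive positive definite forms of discriminant `−N`,
computed by Cohen's Algorithm 5.3.5 (see `classNumber_neg_eq_classNumberCount`). [cite: Cohen1993, §5.3.1 Algorithm 5.3.5] -/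
def classNumberCount (N : ℕ) : ℕ := redRowsSum N (countBound N)

/-! ### Unrolling the recursion into a sum over the admissible pairs -/

/-- The admissibility test, read as propositions. [cite: Cohen1993, §5.3.1 Algorithm 5.3.5] -/
theorem redPairOK_iff {N a b : ℕ} : redPairOK N a b = true ↔
    4 * a ∣ b * b + N ∧ a ≤ redPairC N a b ∧ Nat.gcd (Nat.gcd a b) (redPairC N a b) = 1 := by
  simp only [redPairOK, Bool.and_eq_true, decide_eq_true_eq]
  exact ⟨fun ⟨⟨h1, h2⟩, h3⟩ => ⟨Nat.dvd_of_mod_eq_zero h1, h2, h3⟩,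
    fun ⟨h1, h2, h3⟩ => ⟨⟨Nat.mod_eq_zero_of_dvd h1, h2⟩, h3⟩⟩

/-- For an admissible pair, `4a · c(a, b) = b² + N`. [cite: Cohen1993, §5.3.1 Algorithm 5.3.5] -/
theorem four_mul_redPairC {N a b : ℕ} (h : redPairOK N a b = true) : 4 * a * redPairC N a b = b * b + N :=
  Nat.mul_div_cancel' (redPairOK_iff.1 h).1

/-- A pair of the wrong parity contributes nothing: `4a ∣ b² + N` forces `b ≡ N (mod 2)`. [folklore] -/
private theorem redPairCount_eq_zero_of_mod_two_ne {N a b : ℕ} (h : b % 2 ≠ N % 2) : redPairCount N a b = 0 := by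
  rw [redPairCount, if_neg]
  intro hok
  have h2 : 2 ∣ b * b + N := (Dvd.intro (2 * a) (by ring)).trans (redPairOK_iff.1 hok).1
  have key : (b * b + N) % 2 = 0 := Nat.mod_eq_zero_of_dvd h2
  have hb : b * b % 2 = b % 2 := by
    rcases Nat.mod_two_eq_zero_or_one b with h0 | h1
    · simp [Nat.mul_mod, h0]
    · simp [Nat.mul_mod, h1]
  rw [Nat.add_mod, hb] at key
  omega

/-- `redRowSum` is a `Finset` sum. [folklore] -/
private theorem redRowSum_eq_sum (N a k : ℕ) :
    redRowSum N a k = ∑ j ∈ range k, redPairCount N a (2 * j + N % 2) := by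
  induction k with
  | zero => simp [redRowSum]
  | succ k ih => rw [redRowSum, ih, Finset.sum_range_succ]

/-- The full row: `redRowSum N a (redRowLen N a) = ∑_{b ≤ a} redPairCount N a b` (the `b` of the other parity vanish).
[cite: Cohen1993, §5.3.1 Algorithm 5.3.5] -/
theorem redRowSum_redRowLen (N a : ℕ) (ha : 1 ≤ a) :
    redRowSum N a (redRowLen N a) = ∑ b ∈ range (a + 1), redPairCount N a b := by
  rw [redRowSum_eq_sum]
  have hinj : Set.InjOn (fun j => 2 * j + N % 2) (range (redRowLen N a) : Set ℕ) :=
    fun x _ y _ h => by simp only at h; omega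
  rw [show (∑ j ∈ range (redRowLen N a), redPairCount N a (2 * j + N % 2)) =
      ∑ b ∈ (range (redRowLen N a)).image (fun j => 2 * j + N % 2), redPairCount N a b from
    (Finset.sum_image hinj).symm]
  apply Finset.sum_subset
  · intro b hb
    simp only [Finset.mem_image, Finset.mem_range] at hb ⊢
    obtain ⟨j, hj, rfl⟩ := hb
    unfold redRowLen at hj
    omega
  · intro b hb hnot
    apply redPairCount_eq_zero_of_mod_two_ne
    intro hpar
    apply hnot
    simp only [Finset.mem_image, Finset.mem_range] at hb ⊢
    exact ⟨b / 2, by unfold redRowLen; omega, by omega⟩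

/-- `redRowsSum` is a `Finset` sum. [folklore] -/
private theorem redRowsSum_eq_sum (N k : ℕ) :
    redRowsSum N k = ∑ i ∈ range k, redRowSum N (i + 1) (redRowLen N (i + 1)) := by
  induction k with
  | zero => simp [redRowsSum]
  | succ k ih => rw [redRowsSum, ih, Finset.sum_range_succ]

/-- **The set of admissible pairs** `(a, b)`: `1 ≤ a ≤ ⌊√(N/3)⌋`, `0 ≤ b ≤ a`, `redPairOK N a b`.
[cite: Cohen1993, §5.3.1 Algorithm 5.3.5] -/
def redPairSet (N : ℕ) : Finset (ℕ × ℕ) :=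
  ((Icc 1 (countBound N)) ×ˢ (range (countBound N + 1))).filter fun p => p.2 ≤ p.1 ∧ redPairOK N p.1 p.2 = true

/-- Membership in `redPairSet`. [cite: Cohen1993, §5.3.1 Algorithm 5.3.5] -/
theorem mem_redPairSet {N a b : ℕ} : (a, b) ∈ redPairSet N ↔
    1 ≤ a ∧ a ≤ countBound N ∧ b ≤ a ∧ redPairOK N a b = true := by
  simp only [redPairSet, Finset.mem_filter, Finset.mem_product, Finset.mem_Icc, Finset.mem_range]
  exact ⟨fun ⟨⟨⟨h1, h2⟩, _⟩, h3, h4⟩ => ⟨h1, h2, h3, h4⟩,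
    fun ⟨h1, h2, h3, h4⟩ => ⟨⟨⟨h1, h2⟩, by omega⟩, h3, h4⟩⟩

/-- **The counter unrolled**: `classNumberCount N = ∑_{(a,b) ∈ redPairSet N} redPairWeight N a b`.
[cite: Cohen1993, §5.3.1 Algorithm 5.3.5] -/
theorem classNumberCount_eq_sum (N : ℕ) :
    classNumberCount N = ∑ p ∈ redPairSet N, redPairWeight N p.1 p.2 := by
  rw [classNumberCount, redRowsSum_eq_sum]
  have h1 : ∑ i ∈ range (countBound N), redRowSum N (i + 1) (redRowLen N (i + 1)) =
      ∑ a ∈ Icc 1 (countBound N), ∑ b ∈ range (a + 1), redPairCount N a b := by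
    rw [← Finset.Ico_add_one_right_eq_Icc, Finset.sum_Ico_eq_sum_range, Nat.add_sub_cancel]
    refine Finset.sum_congr rfl fun i _ => ?_
    rw [show 1 + i = i + 1 from add_comm 1 i, redRowSum_redRowLen N (i + 1) (by omega)]
  rw [h1, redPairSet, Finset.sum_filter, Finset.sum_product]
  refine Finset.sum_congr rfl fun a ha => ?_
  rw [Finset.mem_Icc] at ha
  rw [show range (a + 1) = (range (countBound N + 1)).filter (fun b => b ≤ a) by
    ext b; simp only [Finset.mem_range, Finset.mem_filter]; omega]
  rw [Finset.sum_filter]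
  refine Finset.sum_congr rfl fun b _ => ?_
  unfold redPairCount
  by_cases hb : b ≤ a <;> by_cases hok : redPairOK N a b = true <;> simp [hb, hok]

/-! ### The bijection with the reduced forms -/

/-- The reduced form `(a, b, c(a, b))` attached to an admissible pair. [cite: Cox2013, §2.A eq. (2.4)] -/
def redPairForm (N a b : ℕ) : BinQF := ⟨(a : ℤ), (b : ℤ), (redPairC N a b : ℤ)⟩

/-- The form `(a, −b, c(a, b))` attached to an admissible pair (reduced exactly off the boundary).
[cite: Cox2013, §2.A eq. (2.4)] -/
def redPairFormNeg (N a b : ℕ) : BinQF := ⟨(a : ℤ), -(b : ℤ), (redPairC N a b : ℤ)⟩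

/-- The pair `(a, |b|)` of a form `(a, b, c)` (for `a ≥ 0`). [cite: Cohen1993, §5.3.1 Algorithm 5.3.5] -/
def absPair (f : BinQF) : ℕ × ℕ := (f.a.natAbs, f.b.natAbs)

/-- `absPair (a, b, c(a,b)) = (a, b)`. [folklore] -/
private theorem absPair_redPairForm (N a b : ℕ) : absPair (redPairForm N a b) = (a, b) := by
  simp [absPair, redPairForm]

/-- `absPair (a, −b, c(a,b)) = (a, b)`. [folklore] -/
private theorem absPair_redPairFormNeg (N a b : ℕ) : absPair (redPairFormNeg N a b) = (a, b) := by
  simp [absPair, redPairFormNeg]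

/-- An admissible pair gives a primitive positive definite form `(a, b, c)` of discriminant `−N`.
[cite: Cox2013, §2.A] -/
theorem isPosPrim_redPairForm {N a b : ℕ} (ha : 1 ≤ a) (hok : redPairOK N a b = true) :
    (redPairForm N a b).IsPosPrim (-(N : ℤ)) where
  disc_eq := by
    have key : ((4 * a * redPairC N a b : ℕ) : ℤ) = ((b * b + N : ℕ) : ℤ) := by rw [four_mul_redPairC hok]
    push_cast at key
    simp only [disc, redPairForm]
    linarith
  a_pos := by simp only [redPairForm]; omega
  primitive := by
    simp only [IsPrimitive, redPairForm, Int.natAbs_natCast]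
    exact (redPairOK_iff.1 hok).2.2

/-- … and so does `(a, −b, c)`. [cite: Cox2013, §2.A] -/
theorem isPosPrim_redPairFormNeg {N a b : ℕ} (ha : 1 ≤ a) (hok : redPairOK N a b = true) :
    (redPairFormNeg N a b).IsPosPrim (-(N : ℤ)) where
  disc_eq := by
    have key : ((4 * a * redPairC N a b : ℕ) : ℤ) = ((b * b + N : ℕ) : ℤ) := by rw [four_mul_redPairC hok]
    push_cast at key
    simp only [disc, redPairFormNeg]
    linarith
  a_pos := by simp only [redPairFormNeg]; omega
  primitive := by
    simp only [IsPrimitive, redPairFormNeg, Int.natAbs_neg, Int.natAbs_natCast]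
    exact (redPairOK_iff.1 hok).2.2

/-- `(a, b, c)` is reduced for an admissible pair with `b ≤ a` (Cox (2.4): `|b| ≤ a ≤ c`, and `b ≥ 0`).
[cite: Cox2013, §2.A eq. (2.4)] -/
theorem isReduced_redPairForm {N a b : ℕ} (hba : b ≤ a) (hok : redPairOK N a b = true) :
    (redPairForm N a b).IsReduced := by
  have hac := (redPairOK_iff.1 hok).2.1
  refine ⟨?_, ?_, fun _ => ?_⟩ <;> simp only [redPairForm, Nat.abs_cast]
  · exact_mod_cast hba
  · exact_mod_cast hac
  · positivity

/-- `(a, −b, c)` is reduced for an admissible pair with `b ≤ a` OFF the boundary `b = 0 ∨ b = a ∨ a = c` (Cox (2.4)).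
[cite: Cox2013, §2.A eq. (2.4)] -/
theorem isReduced_redPairFormNeg {N a b : ℕ} (hba : b ≤ a) (hok : redPairOK N a b = true)
    (hnb : ¬(b = 0 ∨ b = a ∨ a = redPairC N a b)) : (redPairFormNeg N a b).IsReduced := by
  have hac := (redPairOK_iff.1 hok).2.1
  refine ⟨?_, ?_, fun h => ?_⟩ <;> simp only [redPairFormNeg, abs_neg, Nat.abs_cast]
  · exact_mod_cast hba
  · exact_mod_cast hac
  · exfalso
    apply hnb
    simp only [redPairFormNeg, abs_neg, Nat.abs_cast] at h
    rcases h with h | h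
    · exact Or.inr (Or.inl (by exact_mod_cast h))
    · exact Or.inr (Or.inr (by exact_mod_cast h))

/-- **Every reduced form lands in the pair set**: for a reduced primitive positive definite `(a, b, c)` of discriminant `−N`,
`(a, |b|)` is admissible, with `1 ≤ a ≤ ⌊√(N/3)⌋` by Cox (2.8) (`N = 4ac − b² ≥ 3a²`). [cite: Cox2013, §2.A eq. (2.8)] -/
theorem absPair_mem_redPairSet {N : ℕ} {f : BinQF} (hf : f.IsPosPrim (-(N : ℤ))) (hr : f.IsReduced) :
    absPair f ∈ redPairSet N := by
  obtain ⟨hdisc, hapos, hprim⟩ := hf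
  obtain ⟨h1, h2, -⟩ := hr
  simp only [disc] at hdisc
  unfold IsPrimitive at hprim
  set a := f.a.natAbs with ha_def
  set b := f.b.natAbs with hb_def
  set c := f.c.natAbs with hc_def
  have ha : (a : ℤ) = f.a := Int.natAbs_of_nonneg hapos.le
  have hcpos : 0 < f.c := lt_of_lt_of_le hapos h2
  have hc : (c : ℤ) = f.c := Int.natAbs_of_nonneg hcpos.le
  have hbabs : (b : ℤ) = |f.b| := Int.natCast_natAbs f.b
  have hb2 : (b : ℤ) * b = f.b * f.b := Int.natAbs_mul_self' f.b
  have key : 4 * a * c = b * b + N := by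
    have : (4 : ℤ) * a * c = (b : ℤ) * b + N := by rw [hb2, ha, hc]; nlinarith
    exact_mod_cast this
  have hdvd : 4 * a ∣ b * b + N := Dvd.intro c key
  have hcdef : redPairC N a b = c := by rw [redPairC, ← key]; exact Nat.mul_div_cancel_left c (by omega)
  have hba : b ≤ a := by rw [← Nat.cast_le (α := ℤ), hbabs, ha]; exact h1
  have hac : a ≤ c := by rw [← Nat.cast_le (α := ℤ), ha, hc]; exact h2
  have hbb : b * b ≤ a * a := Nat.mul_le_mul hba hba
  have hcc : 4 * (a * a) ≤ 4 * a * c := by rw [← Nat.mul_assoc]; exact Nat.mul_le_mul_left (4 * a) hac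
  have h3a : 3 * (a * a) ≤ N := by omega
  have hale : a ≤ countBound N := by
    rw [countBound, Nat.le_sqrt, Nat.le_div_iff_mul_le (by norm_num)]; omega
  rw [absPair, mem_redPairSet]
  refine ⟨by omega, hale, hba, ?_⟩
  rw [redPairOK_iff, hcdef]
  exact ⟨hdvd, hac, hprim⟩

/-- A reduced form with pair `(a, b)` is `(a, b, c(a,b))` or `(a, −b, c(a,b))`. [cite: Cox2013, §2.A eq. (2.4)] -/
theorem eq_redPairForm_or_of_absPair_eq {N : ℕ} {f : BinQF} (hf : f.IsPosPrim (-(N : ℤ))) {a b : ℕ}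
    (hok : redPairOK N a b = true) (h : absPair f = (a, b)) :
    f = redPairForm N a b ∨ f = redPairFormNeg N a b := by
  obtain ⟨hdisc, hapos, -⟩ := hf
  simp only [disc] at hdisc
  simp only [absPair, Prod.mk.injEq] at h
  obtain ⟨ha', hb'⟩ := h
  have ha : f.a = a := by rw [← ha']; exact (Int.natAbs_of_nonneg hapos.le).symm
  have hb2 : f.b * f.b = (b : ℤ) * b := by rw [← hb']; exact (Int.natAbs_mul_self' f.b).symm
  have key : ((4 * a * redPairC N a b : ℕ) : ℤ) = ((b * b + N : ℕ) : ℤ) := by rw [four_mul_redPairC hok]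
  push_cast at key
  have ha0 : (0 : ℤ) < a := by rw [← ha]; exact hapos
  have hc : f.c = redPairC N a b := by
    have e : (4 : ℤ) * a * f.c = 4 * a * redPairC N a b := by rw [key, ← hb2, ← ha]; nlinarith
    exact mul_left_cancel₀ (by positivity : (4 : ℤ) * a ≠ 0) e
  rcases Int.natAbs_eq f.b with hb | hb <;> rw [hb'] at hb
  · exact Or.inl (by ext <;> simp [redPairForm, ha, hb, hc])
  · exact Or.inr (by ext <;> simp [redPairFormNeg, ha, hb, hc])

/-- **The fibre over an admissible pair**: among the reduced primitive positive definite forms of discriminant `−N`, those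
with pair `(a, b)` are exactly `{(a, b, c)}` on the boundary `b = 0 ∨ b = a ∨ a = c` and `{(a, b, c), (a, −b, c)}` off it
(Cox (2.4)). [cite: Cox2013, §2.A eq. (2.4) and Thm. 2.8] -/
theorem filter_absPair_eq {N a b : ℕ} (hN : 0 < N) (hp : (a, b) ∈ redPairSet N) :
    (reducedFormsList (-(N : ℤ))).toFinset.filter (fun f => absPair f = (a, b)) =
      if b = 0 ∨ b = a ∨ a = redPairC N a b then {redPairForm N a b}
      else {redPairForm N a b, redPairFormNeg N a b} := by
  have hD : -(N : ℤ) < 0 := by omega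
  obtain ⟨ha1, -, hba, hok⟩ := mem_redPairSet.1 hp
  ext f
  simp only [Finset.mem_filter, List.mem_toFinset, mem_reducedFormsList_iff _ hD]
  constructor
  · rintro ⟨⟨hpp, hred⟩, habs⟩
    rcases eq_redPairForm_or_of_absPair_eq hpp hok habs with rfl | rfl
    · split_ifs <;> simp
    · split_ifs with hbd
      · -- on the boundary `(a, −b, c)` is reduced only if `b = 0`, where it IS `(a, b, c)`
        rw [Finset.mem_singleton]
        obtain ⟨-, -, h3⟩ := hred
        simp only [redPairFormNeg, abs_neg, Nat.abs_cast, Left.nonneg_neg_iff] at h3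
        have hb0 : b = 0 := by
          rcases hbd with h | h | h
          · exact h
          · have := h3 (Or.inl (by exact_mod_cast h)); omega
          · have := h3 (Or.inr (by exact_mod_cast h)); omega
        subst hb0
        ext <;> simp [redPairForm, redPairFormNeg]
      · simp
  · intro hf
    split_ifs at hf with hbd
    · rw [Finset.mem_singleton] at hf
      subst hf
      exact ⟨⟨isPosPrim_redPairForm ha1 hok, isReduced_redPairForm hba hok⟩, absPair_redPairForm N a b⟩
    · rw [Finset.mem_insert, Finset.mem_singleton] at hf
      rcases hf with rfl | rfl
      · exact ⟨⟨isPosPrim_redPairForm ha1 hok, isReduced_redPairForm hba hok⟩, absPair_redPairForm N a b⟩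
      · exact ⟨⟨isPosPrim_redPairFormNeg ha1 hok, isReduced_redPairFormNeg hba hok hbd⟩,
          absPair_redPairFormNeg N a b⟩

/-- The fibre over an admissible pair has `redPairWeight N a b` elements. [cite: Cohen1993, §5.3.1 Algorithm 5.3.5] -/
theorem card_filter_absPair_eq {N a b : ℕ} (hN : 0 < N) (hp : (a, b) ∈ redPairSet N) :
    ((reducedFormsList (-(N : ℤ))).toFinset.filter (fun f => absPair f = (a, b))).card = redPairWeight N a b := by
  rw [filter_absPair_eq hN hp, redPairWeight]
  split_ifs with h
  · rfl
  · rw [Finset.card_pair]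
    intro heq
    have := congrArg BinQF.b heq
    simp only [redPairForm, redPairFormNeg] at this
    omega

/-- **The number of reduced forms of discriminant `−N` is the weighted number of admissible pairs.**
[cite: Cohen1993, §5.3.1 Algorithm 5.3.5] -/
theorem card_reducedForms_eq_sum {N : ℕ} (hN : 0 < N) :
    (reducedFormsList (-(N : ℤ))).toFinset.card = ∑ p ∈ redPairSet N, redPairWeight N p.1 p.2 := by
  have hD : -(N : ℤ) < 0 := by omega
  rw [Finset.card_eq_sum_card_fiberwise (f := absPair) (t := redPairSet N) ?_]
  · refine Finset.sum_congr rfl fun p hp => ?_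
    obtain ⟨a, b⟩ := p
    exact card_filter_absPair_eq hN hp
  · intro f hf
    have hf' : f ∈ (reducedFormsList (-(N : ℤ))).toFinset := hf
    rw [List.mem_toFinset, mem_reducedFormsList_iff _ hD] at hf'
    exact absPair_mem_redPairSet hf'.1 hf'.2

/-! ### The class number by the pair counter -/

/-- **`h(−N)` by Cohen's Algorithm 5.3.5**: `classNumber (−N) = classNumberCount N` for every `N > 0`.
[cite: Cohen1993, §5.3.1 Algorithm 5.3.5] -/
theorem classNumber_neg_eq_classNumberCount {N : ℕ} (hN : 0 < N) :
    classNumber (-(N : ℤ)) = classNumberCount N := by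
  rw [classNumber_eq_card, card_reducedForms_eq_sum hN, classNumberCount_eq_sum]

/-- **`h(D)` by Cohen's Algorithm 5.3.5**, `D`-form: `classNumber D = classNumberCount |D|` for every `D < 0`.
[cite: Cohen1993, §5.3.1 Algorithm 5.3.5] -/
theorem classNumber_eq_classNumberCount {D : ℤ} (hD : D < 0) : classNumber D = classNumberCount D.natAbs := by
  have e : D = -(D.natAbs : ℤ) := by omega
  conv_lhs => rw [e]
  exact classNumber_neg_eq_classNumberCount (by omega)

/-- Regressions against the values already in the tree by the slow route (`classNumberOneDiscrs`, `classNumber_examples`,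
`binQFClassNumber_neg1155 = 8`, `binQFClassNumber_neg77683 = 22`): `h = 1, 1, 2, 3, 8, 22` at
`N = 3, 4, 15, 23, 1155, 77683`. [cite: Cohen1993, §5.3.1 Algorithm 5.3.5] -/
theorem classNumberCount_examples :
    classNumberCount 3 = 1 ∧ classNumberCount 4 = 1 ∧ classNumberCount 15 = 2 ∧ classNumberCount 23 = 3 ∧
      classNumberCount 1155 = 8 ∧ classNumberCount 77683 = 22 := by
  decide +kernel

end BinQF

end Literature.NumberTheory.QuadraticFields.Quadratic
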